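import Summits.Ventures.CertifiedArithmetic.LowPrec.SROptimal
import Summits.Ventures.CertifiedArithmetic.LowPrec.SREscape
import HarnessLib

/-!
# Optimal rounding under a bias budget: the complete solution (file LVII)

HONEST FRAMING: certified error envelopes and provably optimal rounding/accumulation schemes for
low-precision formats under stated cost models; every table by two implementations; no hardware or
vendor claims.

COST MODEL.  A randomised rounding of a value `a` into the finite value set `F` is a probability
vector `w` on `F` (file LV).  Fix a BIAS BUDGET `b ≥ 0` and ask for the least mean-square error
`∑ w(y)(y − a)²` among all `w` with `|∑ w(y)·y − a| ≤ b`.  Round-to-nearest has bias and RMS error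
both equal to `ρ(a) = min(a − ⌊a⌋, ⌈a⌉ − a)` (`nearDist`); stochastic rounding has bias `0` and
MSE `v_F(a) = (a − ⌊a⌋)(⌈a⌉ − a)`.

THE ANSWER (`law_sq_ge_budget` + `srLaw_opt_sq`, packaged as `budget_optimal`), exactly over any
linearly ordered field and for every finite `F`:

  `min { MSE(w) : w a law on F, |bias(w)| ≤ b }  =  v_F(a) − min(b, ρ(a))·|⌊a⌋ + ⌈a⌉ − 2a|`
  (`budgetMSE`), attained by STOCHASTIC ROUNDING OF THE SHIFTED INPUT
  `m⋆ = a ∓ min(b, ρ(a))` (shift towards the NEARER neighbour; `optMean`), i.e. by the two-point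
  law on the cell of `a` with mean `m⋆` (`srLaw`).

So the whole bias/accuracy trade-off for one rounding is a straight line: each unit of permitted
bias buys `|⌊a⌋ + ⌈a⌉ − 2a| = 2·|a − midpoint|` units of MSE, linearly, from the SR point
`(0, v_F(a))` (`budgetMSE_zero`) down to the RN point `(ρ, ρ²)` (`budgetMSE_of_nearDist_le`: once
`b ≥ ρ` randomisation is useless and round-to-nearest is optimal); at a cell midpoint the line is
flat (every two-point law on the cell has MSE `G²/4`).  Nothing off the cell and nothing with more
than two atoms is ever optimal (file LV's off-cell penalty).  As a corollary
(`stepQ_sq_eq_budget_iff`) a limited-random-bits rounding `SR_q` (file XIX; P3109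
`StochasticA/B/C` with any number of bits) is MSE-optimal for ITS OWN bias budget iff its bias
points towards the nearer neighbour — e.g. a floor-type comparator (bias always downwards on the
positive side) is optimal exactly on the lower half of each cell and pessimal on the upper half.

FP4 witness (kernel): E2M1, `a = 9/8` (cell `[1, 3/2]`, `v = 3/64`, `ρ = 1/8`): with budget
`b = 1/16` the optimum is `1/32`, attained by `SR(17/16)`; with `b ≥ 1/8` it is `1/64 = ρ²` (RN).

Nearest prior art (searched; the unit's FRESHNESS file, gen12): the biased two-point schemes
`SR_ε` / signed-`SR_ε` of Xia–Massei–Hochstenbach–Koren (arXiv:2202.12276, Def. 2–3: SR of an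
input shifted by `ε·(⌈x⌉ − ⌊x⌋)` away from zero, resp. in a chosen direction; proposed for
gradient descent, no error-optimality statement) are points on this line; by `step_optMean_sq`
and `law_sq_ge_budget` such a scheme is MSE-optimal for the bias it spends exactly when its
shift points to the nearer neighbour.  Dither theory optimises noise power under
moment-independence constraints, a different cost model.
-/

namespace Summit.Ventures.CertifiedArithmetic.LowPrec.SR

open Literature.ComputerArithmetic.ConnollyHighamMary2021
open Finset

section Generic

variable {K : Type*} [Field K] [LinearOrder K] [IsStrictOrderedRing K]

/-! ### The value function -/

/-- Distance from `a` to its nearer SR candidate, `ρ(a) = min(a − ⌊a⌋, ⌈a⌉ − a)`: the absolute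
error (and bias) of round-to-nearest. -/
def nearDist (F : Finset K) (a : K) : K := min (a - dn F a) (up F a - a)

/-- The bias-budget value function `B(a, b) = v_F(a) − min(b, ρ(a))·|⌊a⌋ + ⌈a⌉ − 2a|`. -/
def budgetMSE (F : Finset K) (a b : K) : K :=
  srVar F a - min b (nearDist F a) * |dn F a + up F a - 2 * a|

/-- The optimal biased target: `a` shifted by `min(b, ρ(a))` towards its nearer neighbour
(downwards on the lower half of the cell, upwards on the upper half). -/
def optMean (F : Finset K) (a b : K) : K :=
  if 2 * a ≤ dn F a + up F a then a - min b (nearDist F a) else a + min b (nearDist F a)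

/-- `ρ(a) ≥ 0` inside the hull. -/
theorem nearDist_nonneg {F : Finset K} {a : K} (ha : InHull F a) : 0 ≤ nearDist F a :=
  le_min (sub_nonneg.mpr (dn_le_of_inHull ha)) (sub_nonneg.mpr (le_up_of_inHull ha))

/-- The RN end of the line: `v_F(a) − ρ(a)·|⌊a⌋ + ⌈a⌉ − 2a| = ρ(a)²`. -/
theorem srVar_sub_nearDist_mul {F : Finset K} {a : K} (ha : InHull F a) :
    srVar F a - nearDist F a * |dn F a + up F a - 2 * a| = nearDist F a ^ 2 := by
  rw [srVar_eq_dn_up ha]; unfold nearDist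
  rcases le_total (a - dn F a) (up F a - a) with h | h
  · rw [min_eq_left h, abs_of_nonneg (by linarith)]; ring
  · rw [min_eq_right h, abs_of_nonpos (by linarith)]; ring

/-- `min((a − ⌊a⌋)², (⌈a⌉ − a)²) = ρ(a)²`. -/
theorem min_sq_eq_nearDist_sq {F : Finset K} {a : K} (ha : InHull F a) :
    min ((a - dn F a) ^ 2) ((up F a - a) ^ 2) = nearDist F a ^ 2 := by
  have hs := sub_nonneg.mpr (dn_le_of_inHull ha)
  have ht := sub_nonneg.mpr (le_up_of_inHull ha)
  unfold nearDist
  rcases le_total (a - dn F a) (up F a - a) with h | h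
  · rw [min_eq_left h, min_eq_left (by nlinarith)]
  · rw [min_eq_right h, min_eq_right (by nlinarith)]

/-- SR regime: with no bias allowed the value is the SR variance, `B(a, 0) = v_F(a)`. -/
theorem budgetMSE_zero {F : Finset K} {a : K} (ha : InHull F a) : budgetMSE F a 0 = srVar F a := by
  unfold budgetMSE; rw [min_eq_left (nearDist_nonneg ha)]; ring

omit [IsStrictOrderedRing K] in
/-- Linear regime: for `b ≤ ρ(a)`, `B(a, b) = v_F(a) − b·|⌊a⌋ + ⌈a⌉ − 2a|` — each unit of bias
buys `2|a − midpoint|` units of MSE. -/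
theorem budgetMSE_of_le_nearDist {F : Finset K} {a b : K} (hb : b ≤ nearDist F a) :
    budgetMSE F a b = srVar F a - b * |dn F a + up F a - 2 * a| := by
  unfold budgetMSE; rw [min_eq_left hb]

/-- RN regime: for `b ≥ ρ(a)` the value is the round-to-nearest error `ρ(a)²` — extra bias budget
beyond `ρ` buys nothing and randomisation is useless. -/
theorem budgetMSE_of_nearDist_le {F : Finset K} {a b : K} (ha : InHull F a)
    (hb : nearDist F a ≤ b) : budgetMSE F a b = nearDist F a ^ 2 := by
  unfold budgetMSE; rw [min_eq_right hb]; exact srVar_sub_nearDist_mul ha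

/-- The value function is non-increasing in the budget. -/
theorem budgetMSE_antitone {F : Finset K} (a : K) {b₁ b₂ : K} (h : b₁ ≤ b₂) :
    budgetMSE F a b₂ ≤ budgetMSE F a b₁ := by
  unfold budgetMSE
  have := mul_le_mul_of_nonneg_right (min_le_min_right (nearDist F a) h)
    (abs_nonneg (dn F a + up F a - 2 * a))
  linarith

/-! ### Lower bound: no law within the budget does better -/

/-- **LOWER BOUND.**  For `a` in the hull and ANY randomised rounding `w` into `F` whose bias is
within the budget, `|∑ w(y)·y − a| ≤ b`:  `B(a, b) ≤ ∑ w(y)(y − a)²`.  (Frontier inequality of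
file LV for `b ≤ ρ`, the round-to-nearest floor for `b ≥ ρ`.) [new] -/
theorem law_sq_ge_budget {F : Finset K} {a : K} (ha : InHull F a) {w : K → K}
    (hw : ∀ y ∈ F, 0 ≤ w y) (h1 : ∑ y ∈ F, w y = 1) {b : K}
    (hb : |(∑ y ∈ F, w y * y) - a| ≤ b) :
    budgetMSE F a b ≤ ∑ y ∈ F, w y * (y - a) ^ 2 := by
  unfold budgetMSE
  rcases le_total b (nearDist F a) with hb' | hb'
  · rw [min_eq_left hb']
    have hfr := law_sq_ge_frontier ha hw h1
    have h2 : -(|(∑ y ∈ F, w y * y) - a| * |dn F a + up F a - 2 * a|)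
        ≤ ((∑ y ∈ F, w y * y) - a) * (dn F a + up F a - 2 * a) := by
      rw [← abs_mul]; exact neg_abs_le _
    have h3 := mul_le_mul_of_nonneg_right hb (abs_nonneg (dn F a + up F a - 2 * a))
    linarith
  · rw [min_eq_right hb', srVar_sub_nearDist_mul ha, ← min_sq_eq_nearDist_sq ha]
    exact law_sq_ge_nearest ha hw h1

/-! ### Attainment: stochastic rounding of the shifted input -/

/-- For `m` in the (closed) cell of `a`, the MSE about `a` of `SR_F(m)` is ON the frontier line:
`E (SR_F(m) − a)² = v_F(a) + (m − a)(⌊a⌋ + ⌈a⌉ − 2a)`. [new] -/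
theorem step_shift_sq {F : Finset K} {a m : K} (ha : InHull F a) (h1 : dn F a ≤ m)
    (h2 : m ≤ up F a) :
    step F m (fun z => (z - a) ^ 2) = srVar F a + (m - a) * (dn F a + up F a - 2 * a) := by
  rw [step_eq_affine ha h1 h2, srVar_eq_dn_up ha]
  rcases eq_or_lt_of_le (le_trans h1 h2) with hdu | hdu
  · -- degenerate cell `⌊a⌋ = ⌈a⌉ (= a = m)`: the shifted law is the point mass
    have hma : m = dn F a := le_antisymm (by rw [hdu]; exact h2) h1
    rw [hma, ← hdu]
    simp only [sub_self, zero_mul, add_zero]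
    ring
  · have hne : up F a - dn F a ≠ 0 := sub_ne_zero.mpr (ne_of_gt hdu)
    field_simp
    ring

omit [Field K] [IsStrictOrderedRing K] in
/-- A point of the closed cell of `a` is in the hull. -/
theorem inHull_of_mem_cell {F : Finset K} {a m : K} (ha : InHull F a) (h1 : dn F a ≤ m)
    (h2 : m ≤ up F a) : InHull F m := by
  have hF : F.Nonempty := by obtain ⟨⟨z, hz, -⟩, -⟩ := ha; exact ⟨z, hz⟩
  exact ⟨⟨dn F a, dn_mem hF a, h1⟩, ⟨up F a, up_mem hF a, h2⟩⟩

omit [IsStrictOrderedRing K] in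
/-- For `m` in the cell of `a`, `SR_F(m)` has mean `m`, i.e. bias `m − a` about `a`. -/
theorem step_shift_id {F : Finset K} {a m : K} (ha : InHull F a) (h1 : dn F a ≤ m)
    (h2 : m ≤ up F a) : step F m (fun z => z) = m := by
  rw [step_id, clamp_eq_self (inHull_of_mem_cell ha h1 h2)]

/-- The optimal target lies in the closed cell of `a` (`0 ≤ b`). -/
theorem optMean_mem_cell {F : Finset K} {a b : K} (ha : InHull F a) (hb : 0 ≤ b) :
    dn F a ≤ optMean F a b ∧ optMean F a b ≤ up F a := by
  have hs := dn_le_of_inHull ha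
  have ht := le_up_of_inHull ha
  have hmin0 : 0 ≤ min b (nearDist F a) := le_min hb (nearDist_nonneg ha)
  unfold optMean
  split_ifs with h
  · have : min b (nearDist F a) ≤ a - dn F a :=
      le_trans (min_le_right _ _) (min_le_left _ _)
    exact ⟨by linarith, by linarith⟩
  · have : min b (nearDist F a) ≤ up F a - a :=
      le_trans (min_le_right _ _) (min_le_right _ _)
    exact ⟨by linarith, by linarith⟩

/-- The optimal target uses bias exactly `min(b, ρ(a)) ≤ b`. -/
theorem abs_optMean_sub {F : Finset K} {a b : K} (ha : InHull F a) (hb : 0 ≤ b) :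
    |optMean F a b - a| = min b (nearDist F a) := by
  have hmin0 : 0 ≤ min b (nearDist F a) := le_min hb (nearDist_nonneg ha)
  unfold optMean
  split_ifs with h
  · rw [show a - min b (nearDist F a) - a = -min b (nearDist F a) by ring, abs_neg,
      abs_of_nonneg hmin0]
  · rw [show a + min b (nearDist F a) - a = min b (nearDist F a) by ring, abs_of_nonneg hmin0]

/-- **ATTAINMENT.**  Stochastic rounding of the shifted input `m⋆ = optMean F a b` has bias within
the budget and MSE exactly `B(a, b)`. [new] -/
theorem step_optMean_sq {F : Finset K} {a b : K} (ha : InHull F a) (hb : 0 ≤ b) :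
    |step F (optMean F a b) (fun z => z) - a| ≤ b ∧
    step F (optMean F a b) (fun z => (z - a) ^ 2) = budgetMSE F a b := by
  obtain ⟨h1, h2⟩ := optMean_mem_cell ha hb
  refine ⟨?_, ?_⟩
  · rw [step_shift_id ha h1 h2, abs_optMean_sub ha hb]; exact min_le_left _ _
  · rw [step_shift_sq ha h1 h2]
    unfold budgetMSE optMean
    split_ifs with h
    · rw [abs_of_nonneg (by linarith)]; ring
    · rw [abs_of_neg (by linarith)]; ring

/-! ### The attaining object as a law on `F` -/

/-- The SR law at `m` as a probability vector on `F`: mass `1 − pUp` at `⌊m⌋`, `pUp` at `⌈m⌉`. -/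
def srLaw (F : Finset K) (m : K) (y : K) : K :=
  if y = dn F m then 1 - pUp F m else if y = up F m then pUp F m else 0

/-- The SR law is a probability vector: nonnegative … -/
theorem srLaw_nonneg (F : Finset K) (m y : K) : 0 ≤ srLaw F m y := by
  unfold srLaw; split_ifs
  · exact sub_nonneg.mpr (pUp_le_one F m)
  · exact pUp_nonneg F m
  · exact le_rfl

omit [IsStrictOrderedRing K] in
/-- In the degenerate cell (`⌊m⌋ = ⌈m⌉`) the up-probability is `0`. -/
theorem pUp_eq_zero_of_dn_eq_up {F : Finset K} {m : K} (h : dn F m = up F m) : pUp F m = 0 := by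
  unfold pUp probUp
  unfold dn up at h
  rw [h, sub_self, div_zero]

omit [IsStrictOrderedRing K] in
/-- … and integrating any `g` against it gives the one-step operator: `∑ srLaw(y) g(y) = E g(SR m)`.
In particular (with `g = 1`) its total mass is `1`. [new] -/
theorem sum_srLaw_mul {F : Finset K} (hF : F.Nonempty) (m : K) (g : K → K) :
    ∑ y ∈ F, srLaw F m y * g y = step F m g := by
  unfold step
  rcases eq_or_ne (dn F m) (up F m) with hdu | hdu
  · rw [Finset.sum_eq_single (dn F m)]
    · simp [srLaw, pUp_eq_zero_of_dn_eq_up hdu, hdu]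
    · intro y _ hy
      have hy' : y ≠ up F m := hdu ▸ hy
      simp [srLaw, hy, hy']
    · intro h; exact absurd (dn_mem hF m) h
  · have e1 : srLaw F m (dn F m) = 1 - pUp F m := by simp [srLaw]
    have e2 : srLaw F m (up F m) = pUp F m := by simp [srLaw, Ne.symm hdu]
    rw [law_sum_of_support (dn_mem hF m) (up_mem hF m) hdu (w := srLaw F m)]
    · rw [e1, e2]; ring
    · intro y _
      by_cases h1 : y = dn F m
      · exact Or.inr (Or.inl h1)
      by_cases h2 : y = up F m
      · exact Or.inr (Or.inr h2)
      exact Or.inl (by simp [srLaw, h1, h2])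

omit [IsStrictOrderedRing K] in
/-- Total mass one. -/
theorem sum_srLaw {F : Finset K} (hF : F.Nonempty) (m : K) : ∑ y ∈ F, srLaw F m y = 1 := by
  have := sum_srLaw_mul hF m (fun _ => 1)
  simp only [mul_one, step_const] at this
  exact this

/-- **OPTIMAL ROUNDING UNDER A BIAS BUDGET — the complete solution.**  For `a` in the hull of a
finite `F` and a budget `b ≥ 0`: (i) every randomised rounding into `F` with `|bias| ≤ b` has
`MSE ≥ B(a, b) = v_F(a) − min(b, ρ(a))·|⌊a⌋ + ⌈a⌉ − 2a|`; (ii) the SR law of the shifted input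
`m⋆ = optMean F a b` is a randomised rounding into `F` with `|bias| ≤ b` and `MSE = B(a, b)`. [new] -/
theorem budget_optimal {F : Finset K} {a b : K} (ha : InHull F a) (hb : 0 ≤ b) :
    (∀ w : K → K, (∀ y ∈ F, 0 ≤ w y) → ∑ y ∈ F, w y = 1 →
        |(∑ y ∈ F, w y * y) - a| ≤ b → budgetMSE F a b ≤ ∑ y ∈ F, w y * (y - a) ^ 2) ∧
    (∀ y ∈ F, 0 ≤ srLaw F (optMean F a b) y) ∧
    ∑ y ∈ F, srLaw F (optMean F a b) y = 1 ∧
    |(∑ y ∈ F, srLaw F (optMean F a b) y * y) - a| ≤ b ∧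
    ∑ y ∈ F, srLaw F (optMean F a b) y * (y - a) ^ 2 = budgetMSE F a b := by
  have hF : F.Nonempty := by obtain ⟨⟨z, hz, -⟩, -⟩ := ha; exact ⟨z, hz⟩
  obtain ⟨hbias, hmse⟩ := step_optMean_sq ha hb
  refine ⟨fun w hw h1 hbw => law_sq_ge_budget ha hw h1 hbw, fun y _ => srLaw_nonneg F _ y,
    sum_srLaw hF _, ?_, ?_⟩
  · rw [sum_srLaw_mul hF _ (fun z => z)]; exact hbias
  · rw [sum_srLaw_mul hF _ (fun z => (z - a) ^ 2)]; exact hmse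

/-- **The price of unbiasedness, exactly.**  Insisting on zero bias costs `v_F(a) − ρ(a)²`
`= ρ(a)·|⌊a⌋ + ⌈a⌉ − 2a|` in MSE over round-to-nearest, and every intermediate budget
interpolates linearly. -/
theorem budgetMSE_zero_sub_rn {F : Finset K} {a : K} (ha : InHull F a) :
    budgetMSE F a 0 - nearDist F a ^ 2 = nearDist F a * |dn F a + up F a - 2 * a| := by
  rw [budgetMSE_zero ha, ← srVar_sub_nearDist_mul ha]; ring

/-! ### Limited random bits: optimal for its own budget iff biased towards the nearer neighbour -/

/-- **`SR_q` VERSUS ITS OWN BUDGET.**  A limited-random-bits rounding (file XIX's `stepQ`, any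
probability assignment with `0 ≤ q ≤ 1` on the two candidates) attains the optimum `B(c, |bias_q|)`
for the bias it spends iff that bias points towards the NEARER neighbour,
`bias_q·(⌊c⌋ + ⌈c⌉ − 2c) ≤ 0`; otherwise it is strictly dominated by SR of a shifted input with
the same |bias|. [new] -/
theorem stepQ_sq_eq_budget_iff (F : Finset K) (q : K → K) {c : K} (hc : InHull F c)
    (hq0 : 0 ≤ LimitedBits.pUpQ F q c) (hq1 : LimitedBits.pUpQ F q c ≤ 1) :
    LimitedBits.stepQ F q c (fun z => (z - c) ^ 2)
        = budgetMSE F c |LimitedBits.stepQ F q c (fun z => z) - c|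
      ↔ (LimitedBits.stepQ F q c (fun z => z) - c) * (dn F c + up F c - 2 * c) ≤ 0 := by
  rw [stepQ_sq_eq_frontier F q hc]
  unfold budgetMSE
  set β := LimitedBits.stepQ F q c (fun z => z) - c with hβ
  set e := dn F c + up F c - 2 * c with he
  have hmin0 : 0 ≤ min |β| (nearDist F c) := le_min (abs_nonneg _) (nearDist_nonneg hc)
  constructor
  · intro h
    have : β * e = -(min |β| (nearDist F c) * |e|) := by linarith
    rw [this]; exact neg_nonpos.mpr (mul_nonneg hmin0 (abs_nonneg _))
  · intro h
    have hs := sub_nonneg.mpr (dn_le_of_inHull hc)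
    have ht := sub_nonneg.mpr (le_up_of_inHull hc)
    -- the bias of `SR_q` is `pUpQ·(⌈c⌉ − c) − (1 − pUpQ)·(c − ⌊c⌋)`
    have hβ' : β = LimitedBits.pUpQ F q c * (up F c - c)
        - (1 - LimitedBits.pUpQ F q c) * (c - dn F c) := by
      rw [hβ]; simp only [LimitedBits.stepQ]; ring
    have hP1 := mul_nonneg hq0 ht
    have hP2 := mul_nonneg hq0 hs
    have hP3 := mul_nonneg (sub_nonneg.mpr hq1) hs
    have hP4 := mul_nonneg (sub_nonneg.mpr hq1) ht
    rcases lt_trichotomy e 0 with he0 | he0 | he0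
    · -- upper half of the cell: the nearer neighbour is `⌈c⌉`, and `β ≥ 0`
      have hβ0 : 0 ≤ β := by
        by_contra hneg
        push Not at hneg
        have := mul_pos_of_neg_of_neg hneg he0
        linarith
      have hρ : nearDist F c = up F c - c := by
        unfold nearDist; refine min_eq_right ?_; rw [he] at he0; linarith
      have hle : β ≤ up F c - c := by rw [hβ']; nlinarith
      rw [abs_of_nonneg hβ0, hρ, min_eq_left hle, abs_of_neg he0]; ring
    · rw [he0]; simp
    · -- lower half: the nearer neighbour is `⌊c⌋`, and `β ≤ 0`
      have hβ0 : β ≤ 0 := by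
        by_contra hpos
        push Not at hpos
        have := mul_pos hpos he0
        linarith
      have hρ : nearDist F c = c - dn F c := by
        unfold nearDist; refine min_eq_left ?_; rw [he] at he0; linarith
      have hle : -β ≤ c - dn F c := by rw [hβ']; nlinarith
      rw [abs_of_nonpos hβ0, hρ, min_eq_left hle, abs_of_pos he0]; ring

end Generic

/-! ### Minifloat formats and a kernel-checked FP4 witness -/

section Formats

open Literature.ComputerArithmetic.FloatingPoint

/-- **Format-level statement.**  In every minifloat format `φ` and for every `|a| ≤ maxRat φ`
and budget `b ≥ 0`: no randomised rounding into the value set with `|bias| ≤ b` beats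
`B(a, b)`, and SR of the shifted input `optMean` attains it. [new] -/
theorem valueSet_budget_optimal (φ : Format) {a : ℚ} (ha : |a| ≤ φ.maxRat) {b : ℚ}
    (hb : 0 ≤ b) :
    (∀ w : ℚ → ℚ, (∀ y ∈ MiniFloat.valueSet φ, 0 ≤ w y) → ∑ y ∈ MiniFloat.valueSet φ, w y = 1 →
        |(∑ y ∈ MiniFloat.valueSet φ, w y * y) - a| ≤ b →
          budgetMSE (MiniFloat.valueSet φ) a b ≤ ∑ y ∈ MiniFloat.valueSet φ, w y * (y - a) ^ 2) ∧
    |step (MiniFloat.valueSet φ) (optMean (MiniFloat.valueSet φ) a b) (fun z => z) - a| ≤ b ∧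
    step (MiniFloat.valueSet φ) (optMean (MiniFloat.valueSet φ) a b) (fun z => (z - a) ^ 2)
      = budgetMSE (MiniFloat.valueSet φ) a b := by
  have hin : InHull (MiniFloat.valueSet φ) a := (valueSet_inHull_iff φ a).mpr ha
  exact ⟨(budget_optimal hin hb).1, step_optMean_sq hin hb⟩

/-- **FP4 witness (kernel-checked on the literal E2M1 table).**  `a = 9/8`, cell `[1, 3/2]`,
`v = 3/64`, `ρ = 1/8`, `|⌊a⌋ + ⌈a⌉ − 2a| = 1/4`: budget `0` ↦ `3/64` (SR); budget `1/16` ↦ `1/32`,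
attained by `SR(17/16)` (bias `−1/16`); budget `1/8` and beyond ↦ `1/64 = ρ²` (round-to-nearest). -/
theorem fp4_budget_witness :
    budgetMSE FP4.e2m1 (9 / 8 : ℚ) 0 = 3 / 64 ∧
    budgetMSE FP4.e2m1 (9 / 8 : ℚ) (1 / 16) = 1 / 32 ∧
    optMean FP4.e2m1 (9 / 8 : ℚ) (1 / 16) = 17 / 16 ∧
    step FP4.e2m1 (17 / 16 : ℚ) (fun z => z) = 17 / 16 ∧
    step FP4.e2m1 (17 / 16 : ℚ) (fun z => (z - 9 / 8) ^ 2) = 1 / 32 ∧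
    budgetMSE FP4.e2m1 (9 / 8 : ℚ) (1 / 8) = 1 / 64 ∧
    budgetMSE FP4.e2m1 (9 / 8 : ℚ) 1 = 1 / 64 := by
  decide +kernel

end Formats

end Summit.Ventures.CertifiedArithmetic.LowPrec.SR
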